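import Mathlib
import HarnessLib
import Summits.Ventures.LatticeQCDFlow.Scoring.SU3TraceDeltoid
import Summits.Ventures.LatticeQCDFlow.Scoring.OnePlaquetteSU3

/-!
# The `SU(3)` Weyl density is a polynomial in the trace: `|Δ|² = 27 − 18|t|² + 8 Re t³ − |t|⁴` on the maximal torus, `t = e^{iθ₁} + e^{iθ₂} + e^{−i(θ₁+θ₂)}`

HONEST FRAMING: exact (Metropolis-corrected) sampling algorithms for lattice gauge theory;
figures of merit are autocorrelation/cost numbers at stated couplings and volumes; no
continuum-physics claim.

Venture `LatticeQCDFlow` (cell pub-lqcd), sub-topic `Scoring`; FANOUT row 21 (`su3-base`: the 4D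
`SU(3)` baselines).  NEW WORK of the cell (placement rule), elementary, joining two tree files:
`Scoring/SU3TraceDeltoid` (row 21 GEN-8: the discriminant identity
`|t|⁴ − 8 Re t³ + 18|t|² − 27 = −(|a−b||a−c||b−c|)²` for unimodular `a, b, c` with `abc = 1`) and
row 5's `Scoring/OnePlaquetteSU3` (`weylSU3 θ₁ θ₂ = ∏ (2 − 2cos(θᵢ − θⱼ))`, the Weyl density of the
`SU(3)` one-plaquette integrals, and `reTrSU3`).  No definition is introduced; nothing is cited as
a fact; no number of ours.

Row 5's `SU(3)` one-plaquette oracle integrates class functions against `weylSU3 θ₁ θ₂ dθ₁ dθ₂`;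
row 21's `SU(3)` files show that class functions are functions of the trace
(`Scoring/SU3ConjugacyByTrace`).  This file closes the loop on the torus: the Weyl density ITSELF is
a polynomial in the (complex) trace `t(θ₁, θ₂) = e^{iθ₁} + e^{iθ₂} + e^{−i(θ₁+θ₂)}`,

  `weylSU3 θ₁ θ₂ = 27 − 18 |t|² + 8 Re(t³) − |t|⁴`,

i.e. minus the deltoid polynomial — non-negative exactly because the trace lies in the deltoid, and
vanishing exactly on its boundary.  In the real coordinates `R = Re t = reTrSU3 θ₁ θ₂`,
`I = Im t = sin θ₁ + sin θ₂ − sin(θ₁ + θ₂)`: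
`weylSU3 = 27 − 18(R² + I²) + 8(R³ − 3RI²) − (R² + I²)²`.

## What is proved

* `torusTrace_prod_eq_one` — the three (unimodular) torus eigenvalues have product `1`; `re_torusTrace_eq_reTrSU3`, `im_torusTrace_eq`.
* **`weylSU3_eq_prod_normSq`** — `weylSU3 θ₁ θ₂ = |a − b|²|a − c|²|b − c|²` for the three torus
  eigenvalues `a, b, c`; **`weylSU3_eq_trace_polynomial`** — `weylSU3 θ₁ θ₂ = 27 − 18‖t‖² + 8 Re(t³) − ‖t‖⁴`.
* **`weylSU3_eq_re_im_polynomial`** — the same in the real coordinates `(R, I)`.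
* `deltoid_polynomial_nonneg_on_torus` — hence `27 − 18‖t‖² + 8 Re(t³) − ‖t‖⁴ ≥ 0` on the torus
  (re-deriving row 5's `weylSU3_nonneg` from the deltoid side, as a consistency check).

NOT CLAIMED: the push-forward of Haar measure to the trace variable (its density with respect to
planar Lebesgue measure on the deltoid involves the Jacobian `∂(R, I)/∂(θ₁, θ₂)` and is NOT this
polynomial); any integral identity; anything for `N ≠ 3`.
-/

namespace Summit.Ventures.LatticeQCDFlow.Scoring

open Complex Real

/-- The three torus eigenvalues `e^{iθ₁}, e^{iθ₂}, e^{−i(θ₁+θ₂)}` multiply to `1`. -/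
theorem torusTrace_prod_eq_one (θ₁ θ₂ : ℝ) :
    Complex.exp ((θ₁ : ℂ) * Complex.I) * Complex.exp ((θ₂ : ℂ) * Complex.I) *
      Complex.exp (((-(θ₁ + θ₂) : ℝ) : ℂ) * Complex.I) = 1 := by
  rw [← Complex.exp_add, ← Complex.exp_add]
  have h : (θ₁ : ℂ) * Complex.I + (θ₂ : ℂ) * Complex.I + ((-(θ₁ + θ₂) : ℝ) : ℂ) * Complex.I = 0 := by
    push_cast; ring
  rw [h, Complex.exp_zero]

/-- The real part of the torus trace is row 5's `reTrSU3`. -/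
theorem re_torusTrace_eq_reTrSU3 (θ₁ θ₂ : ℝ) :
    (Complex.exp ((θ₁ : ℂ) * Complex.I) + Complex.exp ((θ₂ : ℂ) * Complex.I) +
      Complex.exp (((-(θ₁ + θ₂) : ℝ) : ℂ) * Complex.I)).re = reTrSU3 θ₁ θ₂ := by
  simp only [Complex.add_re, Complex.exp_ofReal_mul_I_re, reTrSU3, Real.cos_neg]

/-- The imaginary part of the torus trace: `sin θ₁ + sin θ₂ − sin(θ₁ + θ₂)`. -/
theorem im_torusTrace_eq (θ₁ θ₂ : ℝ) :
    (Complex.exp ((θ₁ : ℂ) * Complex.I) + Complex.exp ((θ₂ : ℂ) * Complex.I) +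
      Complex.exp (((-(θ₁ + θ₂) : ℝ) : ℂ) * Complex.I)).im
        = Real.sin θ₁ + Real.sin θ₂ - Real.sin (θ₁ + θ₂) := by
  simp only [Complex.add_im, Complex.exp_ofReal_mul_I_im, Real.sin_neg]
  ring

/-- **The Weyl density as a product of squared chord lengths**: with `a = e^{iθ₁}`, `b = e^{iθ₂}`,
`c = e^{−i(θ₁+θ₂)}`, `weylSU3 θ₁ θ₂ = |a − b|² |a − c|² |b − c|²`. -/
theorem weylSU3_eq_prod_normSq (θ₁ θ₂ : ℝ) :
    weylSU3 θ₁ θ₂ =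
      ‖Complex.exp ((θ₁ : ℂ) * Complex.I) - Complex.exp ((θ₂ : ℂ) * Complex.I)‖ ^ 2 *
        ‖Complex.exp ((θ₁ : ℂ) * Complex.I) - Complex.exp (((-(θ₁ + θ₂) : ℝ) : ℂ) * Complex.I)‖ ^ 2 *
        ‖Complex.exp ((θ₂ : ℂ) * Complex.I) - Complex.exp (((-(θ₁ + θ₂) : ℝ) : ℂ) * Complex.I)‖ ^ 2 := by
  have h12 : ‖Complex.exp ((θ₁ : ℂ) * Complex.I) - Complex.exp ((θ₂ : ℂ) * Complex.I)‖ ^ 2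
      = 2 - 2 * Real.cos (θ₁ - θ₂) := by
    rw [Complex.sq_norm, Complex.normSq_apply]
    simp only [Complex.sub_re, Complex.sub_im, Complex.exp_ofReal_mul_I_re, Complex.exp_ofReal_mul_I_im]
    rw [Real.cos_sub]
    nlinarith [Real.sin_sq_add_cos_sq θ₁, Real.sin_sq_add_cos_sq θ₂]
  have h13 : ‖Complex.exp ((θ₁ : ℂ) * Complex.I) - Complex.exp (((-(θ₁ + θ₂) : ℝ) : ℂ) * Complex.I)‖ ^ 2
      = 2 - 2 * Real.cos (2 * θ₁ + θ₂) := by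
    rw [Complex.sq_norm, Complex.normSq_apply]
    simp only [Complex.sub_re, Complex.sub_im, Complex.exp_ofReal_mul_I_re, Complex.exp_ofReal_mul_I_im]
    have e : 2 * θ₁ + θ₂ = θ₁ - (-(θ₁ + θ₂)) := by ring
    rw [e, Real.cos_sub]
    nlinarith [Real.sin_sq_add_cos_sq θ₁, Real.sin_sq_add_cos_sq (-(θ₁ + θ₂))]
  have h23 : ‖Complex.exp ((θ₂ : ℂ) * Complex.I) - Complex.exp (((-(θ₁ + θ₂) : ℝ) : ℂ) * Complex.I)‖ ^ 2
      = 2 - 2 * Real.cos (θ₁ + 2 * θ₂) := by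
    rw [Complex.sq_norm, Complex.normSq_apply]
    simp only [Complex.sub_re, Complex.sub_im, Complex.exp_ofReal_mul_I_re, Complex.exp_ofReal_mul_I_im]
    have e : θ₁ + 2 * θ₂ = θ₂ - (-(θ₁ + θ₂)) := by ring
    rw [e, Real.cos_sub]
    nlinarith [Real.sin_sq_add_cos_sq θ₂, Real.sin_sq_add_cos_sq (-(θ₁ + θ₂))]
  rw [weylSU3, h12, h13, h23]

/-- **The `SU(3)` Weyl density is minus the deltoid polynomial of the trace**: with
`t = e^{iθ₁} + e^{iθ₂} + e^{−i(θ₁+θ₂)}`, `weylSU3 θ₁ θ₂ = 27 − 18‖t‖² + 8 Re(t³) − ‖t‖⁴`. -/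
theorem weylSU3_eq_trace_polynomial (θ₁ θ₂ : ℝ) :
    weylSU3 θ₁ θ₂ =
      27 - 18 * ‖Complex.exp ((θ₁ : ℂ) * Complex.I) + Complex.exp ((θ₂ : ℂ) * Complex.I) +
              Complex.exp (((-(θ₁ + θ₂) : ℝ) : ℂ) * Complex.I)‖ ^ 2
        + 8 * ((Complex.exp ((θ₁ : ℂ) * Complex.I) + Complex.exp ((θ₂ : ℂ) * Complex.I) +
              Complex.exp (((-(θ₁ + θ₂) : ℝ) : ℂ) * Complex.I)) ^ 3).re
        - ‖Complex.exp ((θ₁ : ℂ) * Complex.I) + Complex.exp ((θ₂ : ℂ) * Complex.I) +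
              Complex.exp (((-(θ₁ + θ₂) : ℝ) : ℂ) * Complex.I)‖ ^ 4 := by
  set a : ℂ := Complex.exp ((θ₁ : ℂ) * Complex.I) with ha
  set b : ℂ := Complex.exp ((θ₂ : ℂ) * Complex.I) with hb
  set c : ℂ := Complex.exp (((-(θ₁ + θ₂) : ℝ) : ℂ) * Complex.I) with hc
  have hdisc := su3Discriminant_real_eq (Complex.norm_exp_ofReal_mul_I θ₁) (Complex.norm_exp_ofReal_mul_I θ₂)
    (Complex.norm_exp_ofReal_mul_I (-(θ₁ + θ₂))) (torusTrace_prod_eq_one θ₁ θ₂)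
  rw [← ha, ← hb, ← hc] at hdisc
  -- the three squared chord lengths are the three factors of `weylSU3`
  have hw : weylSU3 θ₁ θ₂ = ‖a - b‖ ^ 2 * ‖a - c‖ ^ 2 * ‖b - c‖ ^ 2 := by
    rw [weylSU3_eq_prod_normSq, ha, hb, hc]
  rw [hw]
  have hsq : (‖a - b‖ * ‖a - c‖ * ‖b - c‖) ^ 2 = ‖a - b‖ ^ 2 * ‖a - c‖ ^ 2 * ‖b - c‖ ^ 2 := by ring
  rw [← hsq]
  linarith

/-- **The same in the real coordinates** `R = reTrSU3 θ₁ θ₂ = Re t`,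
`I = Im t = sin θ₁ + sin θ₂ − sin(θ₁+θ₂)`:
`weylSU3 θ₁ θ₂ = 27 − 18(R² + I²) + 8(R³ − 3RI²) − (R² + I²)²`. -/
theorem weylSU3_eq_re_im_polynomial (θ₁ θ₂ : ℝ) :
    weylSU3 θ₁ θ₂ =
      27 - 18 * (reTrSU3 θ₁ θ₂ ^ 2 + (Real.sin θ₁ + Real.sin θ₂ - Real.sin (θ₁ + θ₂)) ^ 2)
        + 8 * (reTrSU3 θ₁ θ₂ ^ 3 -
            3 * reTrSU3 θ₁ θ₂ * (Real.sin θ₁ + Real.sin θ₂ - Real.sin (θ₁ + θ₂)) ^ 2)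
        - (reTrSU3 θ₁ θ₂ ^ 2 + (Real.sin θ₁ + Real.sin θ₂ - Real.sin (θ₁ + θ₂)) ^ 2) ^ 2 := by
  rw [weylSU3_eq_trace_polynomial]
  set t : ℂ := Complex.exp ((θ₁ : ℂ) * Complex.I) + Complex.exp ((θ₂ : ℂ) * Complex.I) +
      Complex.exp (((-(θ₁ + θ₂) : ℝ) : ℂ) * Complex.I) with ht
  have hre : t.re = reTrSU3 θ₁ θ₂ := re_torusTrace_eq_reTrSU3 θ₁ θ₂
  have him : t.im = Real.sin θ₁ + Real.sin θ₂ - Real.sin (θ₁ + θ₂) := im_torusTrace_eq θ₁ θ₂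
  have hn2 : ‖t‖ ^ 2 = t.re ^ 2 + t.im ^ 2 := by
    rw [Complex.sq_norm, Complex.normSq_apply]; ring
  have hn4 : ‖t‖ ^ 4 = (t.re ^ 2 + t.im ^ 2) ^ 2 := by
    rw [show (4 : ℕ) = 2 * 2 from rfl, pow_mul, hn2]
  have h3 : (t ^ 3).re = t.re ^ 3 - 3 * t.re * t.im ^ 2 := by
    rw [pow_succ, pow_two]
    simp only [Complex.mul_re, Complex.mul_im]
    ring
  rw [hn2, hn4, h3, hre, him]

/-- Consistency check from the deltoid side: the trace polynomial is non-negative on the torus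
(row 5's `weylSU3_nonneg`, re-derived). -/
theorem deltoid_polynomial_nonneg_on_torus (θ₁ θ₂ : ℝ) :
    0 ≤ 27 - 18 * ‖Complex.exp ((θ₁ : ℂ) * Complex.I) + Complex.exp ((θ₂ : ℂ) * Complex.I) +
              Complex.exp (((-(θ₁ + θ₂) : ℝ) : ℂ) * Complex.I)‖ ^ 2
        + 8 * ((Complex.exp ((θ₁ : ℂ) * Complex.I) + Complex.exp ((θ₂ : ℂ) * Complex.I) +
              Complex.exp (((-(θ₁ + θ₂) : ℝ) : ℂ) * Complex.I)) ^ 3).re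
        - ‖Complex.exp ((θ₁ : ℂ) * Complex.I) + Complex.exp ((θ₂ : ℂ) * Complex.I) +
              Complex.exp (((-(θ₁ + θ₂) : ℝ) : ℂ) * Complex.I)‖ ^ 4 := by
  rw [← weylSU3_eq_trace_polynomial]
  exact weylSU3_nonneg θ₁ θ₂

end Summit.Ventures.LatticeQCDFlow.Scoring
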